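import Literature.Computability.AlgebraicComplexity.LaserFormatPoolingData
import Summits.MatrixMultiplication.MatrixMultiplication.Theorems.SaturationLadderPooledAlpha

/-!
# Pooled level-1 designs — III: `(CW_6 ⊗ CW_7) ⊗ CW_7` and `α ≥ 5/17` (route `SaturationLadder`, lens 1, gen 20)

Cell `decomp-mm`, lens 1 («grading / quantitative ladder»), gen 20, part 5d.  No definitions, no
named facts, no sorry.  Part 5b (`SaturationLadderPooledAlpha`) pooled ONE copy of `CW_6` with
ONE copy of `CW_7` (`α ≥ 27/92 = 0.29347`).  Coppersmith's optimum weights the two factors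
unequally; integer weights `u : v` are reached WITHOUT a tensor-power closure by NESTING the
binary pooling theorem: the laser INPUT data of a pair are again laser data
(`Literature/…/LaserFormatPoolingData.lean`), so `(CW_6 ⊗ CW_7) ⊗ CW_7` is one more application
of `laserMethod_hasFormatValue_pair_of_mul`.  With the exact designs
* `q = 6`: counts `(240, 78, 240, 80, 1, 1)/640` (`X = (80,480,80)/640` natural,
  `Y = Z = (321,318,1)/640`),
* `q = 7` (both copies): counts `(399, 112, 399, 114, 1, 1)/1026` (`X = (114,798,114)/1026`
  natural, `Y = Z = (514,511,1)/1026`),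
the formats are `(A, B, A)` with `A = 6^{3/8} 7^{7/9}`, `B = 6^{78/640} 7^{224/1026}`, the count is
`2^{min_m (H_m + 2H'_m)}` with `2^{H_m + 2H'_m} A² ≥ 648 ≥ R̃` for all three marginals (integer
certificates with multipliers `5` and `3`, transfer `6^{13} ≤ 7^{12}`), and `A^{5/17} ≤ B`
(`7^{11} ≤ 6^{12}`): **`ω(1, 5/17, 1) = 2`, `α ≥ 5/17 = 0.29411…`** (`alpha_ge_5_17`).  The real
optimum of this two-`q` programme is `0.29461…` (Coppersmith 1997: `α > 0.29462`); the next
grade needs level 2 (`CW_q^{⊗2}`, Le Gall 2012) or more factors.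

References: D. Coppersmith, *Rectangular matrix multiplication revisited*, J. Complexity 13
(1997) 42–49, §3 [Coppersmith1997]; Coppersmith–Winograd 1990 §6 [CoppersmithWinograd1990];
Le Gall 2012 §1, Thm 2.1 [LeGall2012]; Le Gall 2014 §5 [LeGall2014].
-/

set_option linter.dupNamespace false
-- (single-conjunct summit: the namespace repeats `MatrixMultiplication`)

noncomputable section

open Finset
open scoped BigOperators

namespace Summit.MatrixMultiplication.MatrixMultiplication.Theorems.SaturationLadderPooled

open Literature.Computability.AlgebraicComplexity
open Literature.Barriers.MatrixMultiplication
open Summit.MatrixMultiplication.MatrixMultiplication.Theorems.SaturationLadderLevelOne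

/-- `11 log 7 ≤ 12 log 6` (`7^{11} ≤ 6^{12}`): used for `A^{5/17} ≤ B`. [folklore] -/
theorem log_seven_eleven_le : 11 * Real.log 7 ≤ 12 * Real.log 6 := by
  have h : (7 : ℝ) ^ 11 ≤ (6 : ℝ) ^ 12 := by norm_num
  have := Real.log_le_log (by positivity) h
  rwa [Real.log_pow, Real.log_pow, Nat.cast_ofNat, Nat.cast_ofNat] at this

set_option exponentiation.threshold 16384 in
set_option maxRecDepth 16384 in
set_option maxHeartbeats 4000000 in
/-- **`ω(1, 5/17, 1) ≤ 2` from `(CW_6 ⊗ CW_7) ⊗ CW_7` with pooled marginal budgets** (Coppersmith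
1997's mechanism with weights `1 : 2`, by nested pooling; exact designs `(240,78,240,80,1,1)/640`
and `(399,112,399,114,1,1)/1026` twice; certificates `Y/Z`: `q = 6` with multiplier `5`,
`x = 2457`; `q = 7` with multiplier `3`, `x = 2368`; `X`: natural, `x = 480`, `798`).
[cite: Coppersmith1997, §3] [cite: CoppersmithWinograd1990, §6] [cite: LeGall2012, Thm. 2.1] -/
theorem omegaRect_one_5_17_one_le_two : omegaRect ℂ 1 ((5 : ℝ) / 17) 1 ≤ 2 := by
  -- the two level-1 designs (the `q = 7` design serves both copies of `CW_7`)
  obtain ⟨P, c, f, g, h, hcS, hcsum, hP, hf, hg, hh, hprod, hP110, hP011, hP101, hH1, hH2, hH3⟩ :=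
    six_design 240 78 240 80 1 1 640 (by norm_num) (by norm_num) (by norm_num) (by norm_num)
      (by norm_num) (by norm_num) (by norm_num)
  obtain ⟨P', c', f', g', h', hcS', hcsum', hP', hf', hg', hh', hprod', hP'110, hP'011, hP'101,
      hH1', hH2', hH3'⟩ :=
    six_design 399 112 399 114 1 1 1026 (by norm_num) (by norm_num) (by norm_num) (by norm_num)
      (by norm_num) (by norm_num) (by norm_num)
  have hP1 : ∑ s, P s = 1 := (law_sum_eq_one' hcS (by norm_num) hcsum hP).1
  have hPS1 : ∑ s ∈ cwSupport₃, P s = 1 := (law_sum_eq_one' hcS (by norm_num) hcsum hP).2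
  have hP'1 : ∑ s, P' s = 1 := (law_sum_eq_one' hcS' (by norm_num) hcsum' hP').1
  have hP'S1 : ∑ s ∈ cwSupport₃, P' s = 1 := (law_sum_eq_one' hcS' (by norm_num) hcsum' hP').2
  -- level-1 block data of the two factors
  have hS6 : ∀ a b c, bigCwTensor ℂ 6 a b c ≠ 0 → (cwLevel₃ a, cwLevel₃ b, cwLevel₃ c) ∈ cwSupport₃ :=
    fun _ _ _ hx => cwLevel₃_mem_support ℂ hx
  have hS7 : ∀ a b c, bigCwTensor ℂ 7 a b c ≠ 0 → (cwLevel₃ a, cwLevel₃ b, cwLevel₃ c) ∈ cwSupport₃ :=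
    fun _ _ _ hx => cwLevel₃_mem_support ℂ hx
  have hv6 : ∀ s ∈ cwSupport₃, (0 : ℝ) < (fun _ : Fin 3 × Fin 3 × Fin 3 => (1 : ℝ)) s :=
    fun _ _ => one_pos
  have h6A : ∀ s ∈ cwSupport₃, (0 : ℝ) < (fun s : Fin 3 × Fin 3 × Fin 3 =>
      ((6 : ℕ) : ℝ) ^ (s.1.val * s.2.1.val)) s := fun s _ => format_six_pos 6 (by norm_num) _ _
  have h6B : ∀ s ∈ cwSupport₃, (0 : ℝ) < (fun s : Fin 3 × Fin 3 × Fin 3 =>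
      ((6 : ℕ) : ℝ) ^ (s.2.1.val * s.2.2.val)) s := fun s _ => format_six_pos 6 (by norm_num) _ _
  have h6C : ∀ s ∈ cwSupport₃, (0 : ℝ) < (fun s : Fin 3 × Fin 3 × Fin 3 =>
      ((6 : ℕ) : ℝ) ^ (s.1.val * s.2.2.val)) s := fun s _ => format_six_pos 6 (by norm_num) _ _
  have h7A : ∀ s ∈ cwSupport₃, (0 : ℝ) < (fun s : Fin 3 × Fin 3 × Fin 3 =>
      ((7 : ℕ) : ℝ) ^ (s.1.val * s.2.1.val)) s := fun s _ => format_six_pos 7 (by norm_num) _ _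
  have h7B : ∀ s ∈ cwSupport₃, (0 : ℝ) < (fun s : Fin 3 × Fin 3 × Fin 3 =>
      ((7 : ℕ) : ℝ) ^ (s.2.1.val * s.2.2.val)) s := fun s _ => format_six_pos 7 (by norm_num) _ _
  have h7C : ∀ s ∈ cwSupport₃, (0 : ℝ) < (fun s : Fin 3 × Fin 3 × Fin 3 =>
      ((7 : ℕ) : ℝ) ^ (s.1.val * s.2.2.val)) s := fun s _ => format_six_pos 7 (by norm_num) _ _
  have hval6 := fun s (hs : s ∈ cwSupport₃) => hasFormatValue_cwComp_six ℂ 6 s hs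
  have hval7 := fun s (hs : s ∈ cwSupport₃) => hasFormatValue_cwComp_six ℂ 7 s hs
  -- the nested pooled format value of `(CW_6 ⊗ CW_7) ⊗ CW_7`
  have key := laserMethod_hasFormatValue_pair_of_mul
    (kroneckerTensor (bigCwTensor ℂ 6) (bigCwTensor ℂ 7)) _ _ _ (pairSupport cwSupport₃ cwSupport₃)
    (pair_support_mem (bigCwTensor ℂ 6) cwLevel₃ cwLevel₃ cwLevel₃ cwSupport₃ hS6
      (bigCwTensor ℂ 7) cwLevel₃ cwLevel₃ cwLevel₃ cwSupport₃ hS7)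
    (appendRows cwTight cwTight) (appendRows cwTight cwTight) (appendRows cwTightγ cwTightγ)
    (appendRows_injective cwTight_injective cwTight_injective)
    (appendRows_injective cwTight_injective cwTight_injective)
    (appendRows_injective cwTightγ_injective cwTightγ_injective)
    (abs_appendRows_le cwTight_bound cwTight_bound) (abs_appendRows_le cwTight_bound cwTight_bound)
    (appendRows_tight cwTight_sum cwTight_sum)
    (pairVal (fun _ : Fin 3 × Fin 3 × Fin 3 => (1 : ℝ)) (fun _ : Fin 3 × Fin 3 × Fin 3 => (1 : ℝ)))
    (pairVal (fun s : Fin 3 × Fin 3 × Fin 3 => ((6 : ℕ) : ℝ) ^ (s.1.val * s.2.1.val))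
      (fun s : Fin 3 × Fin 3 × Fin 3 => ((7 : ℕ) : ℝ) ^ (s.1.val * s.2.1.val)))
    (pairVal (fun s : Fin 3 × Fin 3 × Fin 3 => ((6 : ℕ) : ℝ) ^ (s.2.1.val * s.2.2.val))
      (fun s : Fin 3 × Fin 3 × Fin 3 => ((7 : ℕ) : ℝ) ^ (s.2.1.val * s.2.2.val)))
    (pairVal (fun s : Fin 3 × Fin 3 × Fin 3 => ((6 : ℕ) : ℝ) ^ (s.1.val * s.2.2.val))
      (fun s : Fin 3 × Fin 3 × Fin 3 => ((7 : ℕ) : ℝ) ^ (s.1.val * s.2.2.val)))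
    (pairVal_pos cwSupport₃ cwSupport₃ hv6 hv6) (pairVal_pos cwSupport₃ cwSupport₃ h6A h7A)
    (pairVal_pos cwSupport₃ cwSupport₃ h6B h7B) (pairVal_pos cwSupport₃ cwSupport₃ h6C h7C)
    (hasFormatValue_pair_blocks (bigCwTensor ℂ 6) cwLevel₃ cwLevel₃ cwLevel₃ cwSupport₃ _ _ _ _
      hv6 h6A h6B h6C hval6 (bigCwTensor ℂ 7) cwLevel₃ cwLevel₃ cwLevel₃ cwSupport₃ _ _ _ _
      hv6 h7A h7B h7C hval7)
    (fun s => c (pairFst s) * c' (pairSnd s)) (pairCount_eq_zero cwSupport₃ cwSupport₃ hcS hcS')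
    (by norm_num : 0 < 640 * 1026) (sum_pairCount hcsum hcsum') (pairLaw P P')
    (pairLaw_eq_pairCount_div hP hP')
    (fun i : Fin 3 × Fin 3 => f i.1 * f' i.2) (fun j : Fin 3 × Fin 3 => g j.1 * g' j.2)
    (fun l : Fin 3 × Fin 3 => h l.1 * h' l.2)
    (pairFactor₁_pos cwSupport₃ cwSupport₃ hf hf') (pairFactor₂_pos cwSupport₃ cwSupport₃ hg hg')
    (pairFactor₃_pos cwSupport₃ cwSupport₃ hh hh')
    (pairLaw_productForm cwSupport₃ cwSupport₃ f g h hprod f' g' h' hprod')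
    (bigCwTensor ℂ 7) cwLevel₃ cwLevel₃ cwLevel₃ cwSupport₃ hS7 cwTight cwTight cwTightγ
    cwTight_injective cwTight_injective cwTightγ_injective cwTight_bound cwTight_bound cwTight_sum
    (fun _ : Fin 3 × Fin 3 × Fin 3 => (1 : ℝ))
    (fun s : Fin 3 × Fin 3 × Fin 3 => ((7 : ℕ) : ℝ) ^ (s.1.val * s.2.1.val))
    (fun s : Fin 3 × Fin 3 × Fin 3 => ((7 : ℕ) : ℝ) ^ (s.2.1.val * s.2.2.val))
    (fun s : Fin 3 × Fin 3 × Fin 3 => ((7 : ℕ) : ℝ) ^ (s.1.val * s.2.2.val))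
    hv6 h7A h7B h7C hval7 c' hcS' (by norm_num : 0 < 1026) hcsum' P' hP'
    f' g' h' hf' hg' hh' hprod'
  obtain ⟨eH1, eH2, eH3⟩ := shannonEntropy_marginals_pairLaw hP1 hP'1 (P := P) (P' := P')
  rw [eH1, eH2, eH3,
    prod_pairSupport_pairVal_rpow cwSupport₃ cwSupport₃ (fun _ : Fin 3 × Fin 3 × Fin 3 => (1 : ℝ))
      (fun _ : Fin 3 × Fin 3 × Fin 3 => (1 : ℝ)) P P' hv6 hv6 hPS1 hP'S1,
    prod_pairSupport_pairVal_rpow cwSupport₃ cwSupport₃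
      (fun s : Fin 3 × Fin 3 × Fin 3 => ((6 : ℕ) : ℝ) ^ (s.1.val * s.2.1.val))
      (fun s : Fin 3 × Fin 3 × Fin 3 => ((7 : ℕ) : ℝ) ^ (s.1.val * s.2.1.val)) P P' h6A h7A hPS1 hP'S1,
    prod_pairSupport_pairVal_rpow cwSupport₃ cwSupport₃
      (fun s : Fin 3 × Fin 3 × Fin 3 => ((6 : ℕ) : ℝ) ^ (s.2.1.val * s.2.2.val))
      (fun s : Fin 3 × Fin 3 × Fin 3 => ((7 : ℕ) : ℝ) ^ (s.2.1.val * s.2.2.val)) P P' h6B h7B hPS1 hP'S1,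
    prod_pairSupport_pairVal_rpow cwSupport₃ cwSupport₃
      (fun s : Fin 3 × Fin 3 × Fin 3 => ((6 : ℕ) : ℝ) ^ (s.1.val * s.2.2.val))
      (fun s : Fin 3 × Fin 3 × Fin 3 => ((7 : ℕ) : ℝ) ^ (s.1.val * s.2.2.val)) P P' h6C h7C hPS1 hP'S1,
    prod_six_one, prod_six_one, mul_one, mul_one, mul_one,
    prod_six_formatA 6 P, prod_six_formatA 7 P', prod_six_formatB 6 P, prod_six_formatB 7 P',
    prod_six_formatC 6 P, prod_six_formatC 7 P', hP110, hP011, hP101, hP'110, hP'011, hP'101] at key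
  push_cast at key
  set m : ℝ := min (shannonEntropy (marginalDist₁ P) + shannonEntropy (marginalDist₁ P') +
        shannonEntropy (marginalDist₁ P'))
      (min (shannonEntropy (marginalDist₂ P) + shannonEntropy (marginalDist₂ P') +
          shannonEntropy (marginalDist₂ P'))
        (shannonEntropy (marginalDist₃ P) + shannonEntropy (marginalDist₃ P') +
          shannonEntropy (marginalDist₃ P'))) with hmdef
  -- the numbers
  set A : ℝ := (6 : ℝ) ^ ((240 : ℝ) / 640) * (7 : ℝ) ^ ((399 : ℝ) / 1026) *
    (7 : ℝ) ^ ((399 : ℝ) / 1026) with hAdef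
  set B : ℝ := (6 : ℝ) ^ ((78 : ℝ) / 640) * (7 : ℝ) ^ ((112 : ℝ) / 1026) *
    (7 : ℝ) ^ ((112 : ℝ) / 1026) with hBdef
  have hL6 : 0 < Real.log 6 := Real.log_pos (by norm_num)
  have hL7 : 0 < Real.log 7 := Real.log_pos (by norm_num)
  have hA1 : 1 < A := one_lt_mul_of_lt_of_le (one_lt_mul_of_lt_of_le
    (Real.one_lt_rpow (by norm_num) (by norm_num)) (Real.one_le_rpow (by norm_num) (by norm_num)))
    (Real.one_le_rpow (by norm_num) (by norm_num))
  have hA0 : 0 < A := by linarith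
  have hB0 : 0 < B := by positivity
  have hLA : Real.log A = 240 / 640 * Real.log 6 + 399 / 1026 * Real.log 7 +
      399 / 1026 * Real.log 7 := by
    rw [hAdef, Real.log_mul (mul_pos (Real.rpow_pos_of_pos (by norm_num) _)
      (Real.rpow_pos_of_pos (by norm_num) _)).ne' (Real.rpow_pos_of_pos (by norm_num) _).ne',
      Real.log_mul (Real.rpow_pos_of_pos (by norm_num) _).ne'
      (Real.rpow_pos_of_pos (by norm_num) _).ne', Real.log_rpow (by norm_num),
      Real.log_rpow (by norm_num)]
  have hLB : Real.log B = 78 / 640 * Real.log 6 + 112 / 1026 * Real.log 7 +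
      112 / 1026 * Real.log 7 := by
    rw [hBdef, Real.log_mul (mul_pos (Real.rpow_pos_of_pos (by norm_num) _)
      (Real.rpow_pos_of_pos (by norm_num) _)).ne' (Real.rpow_pos_of_pos (by norm_num) _).ne',
      Real.log_mul (Real.rpow_pos_of_pos (by norm_num) _).ne'
      (Real.rpow_pos_of_pos (by norm_num) _).ne', Real.log_rpow (by norm_num),
      Real.log_rpow (by norm_num)]
  have hlogA : 0 < Real.log A := Real.log_pos hA1
  have hAB : A ^ ((5 : ℝ) / 17) ≤ B := by
    rw [← Real.log_le_log_iff (Real.rpow_pos_of_pos hA0 _) hB0, Real.log_rpow hA0, hLA, hLB]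
    linarith [log_seven_eleven_le]
  -- reading: `2^m A^{ω(1,5/17,1)} ≤ R̃((CW_6 ⊗ CW_7) ⊗ CW_7) ≤ 648`
  have main := mul_rpow_omegaRect_le_asymptoticRank_of_hasFormatValue key hA1
    (by norm_num : (0 : ℝ) ≤ 5 / 17) hAB
  have h6 : asymptoticRank (bigCwTensor ℂ 6) ≤ 8 := by
    have := asymptoticRank_bigCwTensor_le ℂ 6; norm_num at this; exact this
  have h7 : asymptoticRank (bigCwTensor ℂ 7) ≤ 9 := by
    have := asymptoticRank_bigCwTensor_le ℂ 7; norm_num at this; exact this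
  have hR67 : asymptoticRank (kroneckerTensor (bigCwTensor ℂ 6) (bigCwTensor ℂ 7)) ≤ 8 * 9 :=
    (asymptoticRank_kronecker_le _ _).trans
      (mul_le_mul h6 h7 (asymptoticRank_nonneg _) (by norm_num))
  have hR : asymptoticRank (kroneckerTensor (kroneckerTensor (bigCwTensor ℂ 6) (bigCwTensor ℂ 7))
      (bigCwTensor ℂ 7)) ≤ 8 * 9 * 9 :=
    (asymptoticRank_kronecker_le _ _).trans
      (mul_le_mul hR67 h7 (asymptoticRank_nonneg _) (by norm_num))
  have hlog := Real.log_le_log (by positivity) (main.trans hR)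
  rw [Real.log_mul (by positivity) (by positivity), Real.log_rpow two_pos, Real.log_rpow hA0] at hlog
  have h899 : Real.log (8 * 9 * 9) = Real.log 8 + Real.log 9 + Real.log 9 := by
    rw [Real.log_mul (by norm_num) (by norm_num), Real.log_mul (by norm_num) (by norm_num)]
  -- the entropy certificates
  have c6X := entropyCert_scaled (q := 6) (N₀ := 640) (u₀ := 80) (u₁ := 480) (u₂ := 80)
    (x := 480) 1 (by norm_num) (by norm_num) (by norm_num) (by norm_num) (by decide)
  have c6Y := entropyCert_scaled (q := 6) (N₀ := 640) (u₀ := 321) (u₁ := 318) (u₂ := 1)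
    (x := 2457) 5 (by norm_num) (by norm_num) (by norm_num) (by norm_num) (by decide)
  have c7X := entropyCert_scaled (q := 7) (N₀ := 1026) (u₀ := 114) (u₁ := 798) (u₂ := 114)
    (x := 798) 1 (by norm_num) (by norm_num) (by norm_num) (by norm_num) (by decide)
  have c7Y := entropyCert_scaled (q := 7) (N₀ := 1026) (u₀ := 514) (u₁ := 511) (u₂ := 1)
    (x := 2368) 3 (by norm_num) (by norm_num) (by norm_num) (by norm_num) (by decide)
  norm_num at c6X c6Y c7X c7Y hH1 hH2 hH3 hH1' hH2' hH3'
  have hX : Real.log 8 + Real.log 9 + Real.log 9 - 2 * Real.log A ≤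
      Real.log 2 * (shannonEntropy (marginalDist₁ P) + shannonEntropy (marginalDist₁ P') +
        shannonEntropy (marginalDist₁ P')) := by
    rw [hH1, hH1', mul_add, mul_add, hLA]; linarith
  have hY : Real.log 8 + Real.log 9 + Real.log 9 - 2 * Real.log A ≤
      Real.log 2 * (shannonEntropy (marginalDist₂ P) + shannonEntropy (marginalDist₂ P') +
        shannonEntropy (marginalDist₂ P')) := by
    rw [hH2, hH2', mul_add, mul_add, hLA]; linarith [log_six_thirteen_le]
  have hZ : Real.log 8 + Real.log 9 + Real.log 9 - 2 * Real.log A ≤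
      Real.log 2 * (shannonEntropy (marginalDist₃ P) + shannonEntropy (marginalDist₃ P') +
        shannonEntropy (marginalDist₃ P')) := by
    rw [hH3, hH3', mul_add, mul_add, hLA]; linarith [log_six_thirteen_le]
  have hlog2 : 0 < Real.log 2 := Real.log_pos one_lt_two
  have hm : (Real.log 8 + Real.log 9 + Real.log 9 - 2 * Real.log A) / Real.log 2 ≤ m :=
    le_min ((div_le_iff₀' hlog2).2 hX) (le_min ((div_le_iff₀' hlog2).2 hY)
      ((div_le_iff₀' hlog2).2 hZ))
  have hm' : Real.log 8 + Real.log 9 + Real.log 9 - 2 * Real.log A ≤ m * Real.log 2 :=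
    (div_le_iff₀ hlog2).1 hm
  -- conclusion: `ω log A ≤ 2 log A`
  have e1 : omegaRect ℂ 1 ((5 : ℝ) / 17) 1 * Real.log A ≤
      Real.log 8 + Real.log 9 + Real.log 9 - m * Real.log 2 := by
    rw [h899] at hlog; linarith
  have e2 : Real.log 8 + Real.log 9 + Real.log 9 - m * Real.log 2 ≤ 2 * Real.log A := by linarith
  have hfin : omegaRect ℂ 1 ((5 : ℝ) / 17) 1 * Real.log A ≤ 2 * Real.log A := e1.trans e2
  exact le_of_mul_le_mul_right hfin hlogA

/-- **`ω(1, 5/17, 1) = 2`.** [cite: Coppersmith1997, §3] -/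
theorem omegaRect_one_5_17_one : omegaRect ℂ 1 ((5 : ℝ) / 17) 1 = 2 :=
  le_antisymm omegaRect_one_5_17_one_le_two (by
    have := add_le_omegaRect₁₃ ℂ 1 ((5 : ℝ) / 17) 1; linarith)

/-- **`α ≥ 5/17 = 0.29411…`** — the tree's proved dual exponent after gen 20, part 5d
(nested pooling `(CW_6 ⊗ CW_7) ⊗ CW_7`, Coppersmith 1997's mechanism with weights `1 : 2`; was
`27/92 = 0.29347`). [cite: Coppersmith1997, §3] [cite: LeGall2012, §1] -/
theorem alpha_ge_5_17 : (5 : ℝ) / 17 ≤ dualExponentAlpha ℂ :=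
  (omegaRect_eq_two_iff_le_dualExponentAlpha ℂ _).1 omegaRect_one_5_17_one

/-- `α > 0.29411`. [cite: Coppersmith1997, §3] -/
theorem dualExponentAlpha_gt_029411 : (0.29411 : ℝ) < dualExponentAlpha ℂ :=
  lt_of_lt_of_le (by norm_num) alpha_ge_5_17

/-- `ω(1, t, 1) = 2` for every `t ≤ 5/17`. [cite: Coppersmith1997, §3] -/
theorem omegaRect_one_mid_one_eq_two'' {t : ℝ} (ht : t ≤ 5 / 17) : omegaRect ℂ 1 t 1 = 2 :=
  (omegaRect_eq_two_iff_le_dualExponentAlpha ℂ t).2 (ht.trans alpha_ge_5_17)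

end Summit.MatrixMultiplication.MatrixMultiplication.Theorems.SaturationLadderPooled
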